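import Summits.Ventures.HodgeRepro2.T5RecordHyperspecial
import Summits.Ventures.HodgeRepro2.T5InertSphericalEigenvalueCompletion
import Summits.Ventures.HodgeRepro2.T5InertPlaceCompletionCells

/-!
# The record's spherical Hecke algebra at an inert good place is a polynomial algebra `k[T₁]`
(cell pub-hodge-repro2, seat p3)

The Satake chain of this seat (files 186–221, T5-SATAKE-KERNEL-p3.md) lives on `H(U(J₃(u)), K_U)` over the
local package; seat p8's T5-149 (`exists_basis_adicCompletion`) identifies, on Mathlib's completions at an inert
place, the Hecke algebra of any unimodular isotropic hermitian `3 × 3` matrix with that of `J₃(u₀)`; file 231's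
`recordHeckeEquiv` identifies the record's own Hecke algebra `H(U(1 ⊗ H), K_v)` with seat p8's. Composing:
* **`nonempty_algEquiv_polynomial_record`** — at an inert place `w ∣ v` (`θ` a `v`-adic non-square, a uniformiser
  of `O_{K⁺_v}` irreducible in `O_{K_w}`), for the datum's hermitian invertible `3 × 3` Gram matrix `H` over `K`
  good at `w` (file 222), `k[X] ≃ₐ[k] H(U(1 ⊗ H), K_v)`: THE RECORD'S SPHERICAL HECKE ALGEBRA IS A POLYNOMIAL
  ALGEBRA IN ONE VARIABLE (file 187's algebra half of the Satake isomorphism, transported).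
The standing instance hypotheses on `𝒪_{E_v} = integralClosure O_{K⁺_v} K_w` are those of files 207 / 214 / 221
(seat p8's T5-146 / T5-149 provide them on the record's local fields).

Mathlib + this seat's files 180 / 187 / 222 / 231 + seat p8's T5-146 / T5-149 and their imports; no display; no
device. §8(d): uses an L-value-free non-vanishing device: NO.
-/

namespace Summit.Ventures.HodgeRepro2.T5RecordSatake

open Matrix NumberField NumberField.IsCMField IsDedekindDomain IsDedekindDomain.HeightOneSpectrum Module
open scoped TensorProduct Pointwise
open Summit.Ventures.HodgeRepro2.T5UnitaryGroupForm Summit.Ventures.HodgeRepro2.T5UnitaryHeckeAdjoint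
  Summit.Ventures.HodgeRepro2.T5HeckePermutationModule Summit.Ventures.HodgeRepro2.T5StarOfInvolution
  Summit.Ventures.HodgeRepro2.T5FinitePlaceCM Summit.Ventures.HodgeRepro2.T5FinitePlaceNormIndex
  Summit.Ventures.HodgeRepro2.T5NonSplitPlaceUnitaryGroup Summit.Ventures.HodgeRepro2.T5RecordHyperspecial
  Summit.Ventures.HodgeRepro2.T5GlobalLatticeAlmostAll Summit.Ventures.HodgeRepro2.T5HermitianLocalIsotropyN3
  Summit.Ventures.HodgeRepro2.T5FinitePlaceSplitClassification Summit.Ventures.HodgeRepro2.T5HermitianThreeElements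
  Summit.Ventures.HodgeRepro2.T5GaloisCartanThree Summit.Ventures.HodgeRepro2.T5InertDegreeGalois
  Summit.Ventures.HodgeRepro2.T5InertDegreeCompletion Summit.Ventures.HodgeRepro2.T5InertPlaceCompletion
  Summit.Ventures.HodgeRepro2.T5InertDegreeAdicCompletion Summit.Ventures.HodgeRepro2.T5InertSatakeTransform
  Summit.Ventures.HodgeRepro2.T5InertPlaceCompletionCells Summit.Ventures.HodgeRepro2.T5InertTopCoefficient
  Summit.Ventures.HodgeRepro2.T5SplitUnitaryGroupEquiv

section Record

variable (K : Type*) [Field K] [NumberField K] [IsCMField K]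
variable (v : HeightOneSpectrum (𝓞 (maximalRealSubfield K))) (w : HeightOneSpectrum (𝓞 K))
  [w.asIdeal.LiesOver v.asIdeal]
  [IsDiscreteValuationRing (integralClosure (v.adicCompletionIntegers (maximalRealSubfield K)) (w.adicCompletion K))]
  [Finite (IsLocalRing.ResidueField (integralClosure (v.adicCompletionIntegers (maximalRealSubfield K))
    (w.adicCompletion K)))]
  [IsFractionRing (integralClosure (v.adicCompletionIntegers (maximalRealSubfield K)) (w.adicCompletion K))
    (w.adicCompletion K)]
variable {θ : maximalRealSubfield K} {y : K}
  (hθ : algebraMap (maximalRealSubfield K) K θ = y ^ 2) (hy : complexConj K y ≠ y)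
  (hsq : ¬ IsSquare (algebraMap (maximalRealSubfield K) (v.adicCompletion (maximalRealSubfield K)) θ))
  {ϖ : v.adicCompletionIntegers (maximalRealSubfield K)} (hϖ : Irreducible ϖ)
  (hinert : Irreducible (algebraMap (v.adicCompletionIntegers (maximalRealSubfield K)) (w.adicCompletionIntegers K) ϖ))
variable {r : ℕ} (l : Fin r → 𝓞 K)

include hθ hy hsq hϖ hinert in
/-- **THE RECORD'S SPHERICAL HECKE ALGEBRA AT AN INERT GOOD PLACE IS `k[X]`**: for the datum's hermitian invertible
`3 × 3` Gram matrix `H` over `K` good at `w`, `k[X] ≃ₐ[k] H(U(1 ⊗ H), K_v)` — file 187's `k[X] ≃ H(U(J₃(u₀)), K_U)`,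
seat p8's T5-149 `H(U(J₃(u₀)), K_U) ≃ H(U(H_w), K_{H_w})`, and file 231's `recordHeckeEquiv`. -/
theorem nonempty_algEquiv_polynomial_record (k : Type*) [Field k]
    (hl : Submodule.span (𝓞 (maximalRealSubfield K)) (Set.range l) = ⊤)
    {H : Matrix (Fin 3) (Fin 3) K} (hH : H.IsHermitian) (hdet : IsUnit H.det) (hgood : w ∉ badSet H) :
    Nonempty (Polynomial k ≃ₐ[k]
      (letI := tensorStarRing K v; ↥(heckeAlgebra k (recordHyperspecial K v l H)))) := by
  letI := tensorStarRing K v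
  letI := starRingOfQuadratic (finrank_eq_two K v w hθ hy hsq)
    (localConj v w hθ.symm (span_pair_eq_top K hy) hsq (complexConj K))
    (localConj_ne_one v w hθ.symm (span_pair_eq_top K hy) hsq (complexConj K)
      (complexConj_apply_eq_neg K hθ hy))
  -- the local data
  have hst : ∀ x : w.adicCompletion K,
      star x = localConj v w hθ.symm (span_pair_eq_top K hy) hsq (complexConj K) x := fun x => by
    rw [star_p8_eq_star K v w hθ hy hsq]
    rfl
  have hHw := isHermitian_map_p8 K v w hθ hy hsq hH
  have hdetw : IsUnit (H.map (algebraMap K (w.adicCompletion K))).det := isUnit_det_map _ H hdet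
  have hint : ∀ i j, IsLocalization.IsInteger
      (integralClosure (v.adicCompletionIntegers (maximalRealSubfield K)) (w.adicCompletion K))
      ((H.map (algebraMap K (w.adicCompletion K))) i j) := fun i j => by
    rw [isInteger_integralClosure_iff_of_isIntegralClosure (A := w.adicCompletionIntegers K), Matrix.map_apply]
    exact isInteger_of_notMem_badSet hgood i j
  have hint' : ∀ i j, IsLocalization.IsInteger
      (integralClosure (v.adicCompletionIntegers (maximalRealSubfield K)) (w.adicCompletion K))
      ((H.map (algebraMap K (w.adicCompletion K)))⁻¹ i j) := fun i j => by
    rw [isInteger_integralClosure_iff_of_isIntegralClosure (A := w.adicCompletionIntegers K), inv_map _ H hdet,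
      Matrix.map_apply]
    exact isInteger_inv_of_notMem_badSet hgood i j
  have h3 : 2 < Fintype.card (Fin 3) := by rw [Fintype.card_fin]; norm_num
  have hiso := exists_sesqForm_eq_zero_localConj v w hθ.symm (span_pair_eq_top K hy) hsq (complexConj K)
    (complexConj_apply_eq_neg K hθ hy) (finrank_eq_two K v w hθ hy hsq) (ι := Fin 3) h3
    (H := H.map (algebraMap K (w.adicCompletion K))) hHw hdetw
  obtain ⟨x, hx0, hx⟩ := hiso
  -- the two spellings of `K_{H_w}`
  have hK : hyperspecialSubgroup (integralClosure (v.adicCompletionIntegers (maximalRealSubfield K))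
      (w.adicCompletion K)) (H.map (algebraMap K (w.adicCompletion K))) =
      hyperspecialSubgroup (w.adicCompletionIntegers K) (H.map (algebraMap K (w.adicCompletion K))) :=
    hyperspecialSubgroup_integralClosure_eq (R := v.adicCompletionIntegers (maximalRealSubfield K))
      (A := w.adicCompletionIntegers K) _
  have hcast : heckeAlgebra k (hyperspecialSubgroup (integralClosure (v.adicCompletionIntegers (maximalRealSubfield K))
      (w.adicCompletion K)) (H.map (algebraMap K (w.adicCompletion K)))) ≃ₐ[k]
      heckeAlgebra k (hyperspecialSubgroup (w.adicCompletionIntegers K) (H.map (algebraMap K (w.adicCompletion K)))) :=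
    hK ▸ AlgEquiv.refl
  -- seat p8's T5-149: the Hecke algebra of `H_w` is that of `J₃(u₀)`; file 187: `k[X] ≃ H(U(J₃(u₀)), K_U)`
  have hex := exists_basis_adicCompletion v w (finrank_eq_two K v w hθ hy hsq) hϖ hinert
    (localConj v w hθ.symm (span_pair_eq_top K hy) hsq (complexConj K))
    (localConj_ne_one v w hθ.symm (span_pair_eq_top K hy) hsq (complexConj K) (complexConj_apply_eq_neg K hθ hy))
    (H.map (algebraMap K (w.adicCompletion K))) k hHw hint hdetw hint' x hx0 hx
  exact hex.elim fun u₀ h1 => h1.elim fun _ h2 => h2.elim fun ε _ =>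
    (nonempty_algEquiv_polynomial
      (R := integralClosure (v.adicCompletionIntegers (maximalRealSubfield K)) (w.adicCompletion K))
      (hstar_of_star_eq (localConj v w hθ.symm (span_pair_eq_top K hy) hsq (complexConj K)) hst)
      (algebraMap (v.adicCompletionIntegers (maximalRealSubfield K)) (w.adicCompletion K)
        (u₀ : v.adicCompletionIntegers (maximalRealSubfield K)))
      (star_algebraMap_of_star_eq (localConj v w hθ.symm (span_pair_eq_top K hy) hsq (complexConj K)) hst _)
      (algebraMap_unit_ne_zero (F := v.adicCompletion (maximalRealSubfield K)) u₀)
      (isInteger_algebraMap (u₀ : v.adicCompletionIntegers (maximalRealSubfield K)))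
      (isInteger_algebraMap_unit_inv u₀)
      (irreducible_uniformiser (map_maximalIdeal_integralClosure_eq_of_irreducible v w hϖ hinert) hϖ)
      (star_algebraMap_of_star_eq (localConj v w hθ.symm (span_pair_eq_top K hy) hsq (complexConj K)) hst ϖ) k).elim
      fun P => ⟨P.trans (ε.trans (hcast.trans (recordHeckeEquiv K v w hθ hy hsq l k hl H).symm))⟩

end Record

end Summit.Ventures.HodgeRepro2.T5RecordSatake
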